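import Summits.QuantumFields.QCD.Theorems.WilsonMobilityGapChiralMobilityGapAnchorStubUpperOfPionCeiling

/-!
# Crux `ChiralMobilityGap` (stmt-QuantumFields-17497) — line `Ideator3Sketch`, glue stub B′
# `stub_lowerWithOfFloorAndCeiling`: clause (iii) with its rate on the diagonal from a FIRST-moment
# floor and a SECOND-moment ceiling (no self-averaging hypothesis)

Pure probability under the phase-quenched probability measure `qcdLatticeMeasure`, any regularisation,
`N_f ≥ 2` identical flavours.  With `X ≥ 0` the quark-propagator entry sum, `A = E₊[X]`, `B = E₊[X²]`,
`H = E₊[X^{1/2}]`: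

* `first_moment_cube_le` — abstract probability: Hölder interpolation
  `E[X] ≤ E[X^{1/2}]^{2/3} E[X²]^{1/3}` (the landed `moment_interpolation` applied to `√X` with exponents
  `(1, 2, 4)`), cubed: `A³ ≤ H² B`;
* `fm_one_cube_le` — hence, the squared entry sum being phase-quenched integrable at a degenerate tuple
  with `N_f ≥ 2` (`integrable_propSum_sq`, glue stub A's file), `fm(1)³ ≤ fm(1/2)² · fm(2)`;
* `stub_lowerWithOfFloorAndCeiling` — the registered glue stub of skeleton v6: a floor
  `c e^{-(μ a_k n + q log(n+1))} ≤ fm(1)` and a ceiling `fm(2) ≤ C e^{-δ a_k n}` along a degenerate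
  trajectory give `LowerWith reg (t,…,t) (1/2) (c^{3/2} C^{-1/2}) ((3μ-δ)/2) (3q/2)`.

Why this replaces skeleton v5's pair (glue B `stub_lowerWithOfMoments` + physical "no (1,2)-broadening"):
the second-moment CEILING is the pion-ceiling stub read along the time axis, so clause (iii) with a
vanishing rate needs no comparison `fm(2) ≲ fm(1)²` at all — only the two-sided physical-rate sandwich.
-/

noncomputable section

namespace Summit.QuantumFields.QCD.Theorems.ChiralMobilityGapAnchor

open scoped BigOperators Topology
open MeasureTheory Filter Set
open Literature.MathematicalPhysics.QuantumFieldTheory Literature.MathematicalPhysics.QuantumLattice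
  Literature.Probability.LatticeModels
open Summit.QuantumFields.QCD.Theorems.MobilityGapNegative (bare fm ClauseI Upper Lower Sign Clauses)
open Summit.QuantumFields.QCD.Theorems.ChiralMobilityGapSketch (LowerWith VanishingChiralRate lower_iff)
open Summit.QuantumFields.QCD.Theorems.MobilityGapSketch (propSum propSum_nonneg measurable_propSum
  fm_eq_integral negativeFm_eq_fm)
open Summit.QuantumFields.QCD.Theorems.MobilityGapPinch (moment_interpolation)

variable {Nf : ℕ}

/-! ### §1 Abstract probability: the first moment cubed against the half and second moments -/

/-- **`E[X]³ ≤ E[X^{1/2}]² · E[X²]`** on a probability space, for `X ≥ 0` measurable with `X²` integrable: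
Hölder interpolation `E[X] ≤ E[X^{1/2}]^{2/3} E[X²]^{1/3}` (the landed `moment_interpolation` for
`Y = X^{1/2}` with exponents `(1, 2, 4)`), cubed. -/
theorem first_moment_cube_le {α : Type*} [MeasurableSpace α] {μ : Measure α}
    [IsProbabilityMeasure μ] {X : α → ℝ} (hX : Measurable X) (hX0 : ∀ a, 0 ≤ X a)
    (hint : Integrable (fun a => X a ^ (2 : ℝ)) μ) :
    (∫ a, X a ^ (1 : ℝ) ∂μ) ^ (3 : ℝ) ≤ (∫ a, X a ^ (1 / 2 : ℝ) ∂μ) ^ (2 : ℝ) * ∫ a, X a ^ (2 : ℝ) ∂μ := by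
  -- interpolation for `Y = X^{1/2}` with exponents `(1, 2, 4)`
  set Y : α → ℝ := fun a => X a ^ (1 / 2 : ℝ) with hY
  have hY0 : ∀ a, 0 ≤ Y a := fun a => Real.rpow_nonneg (hX0 a) _
  have hYm : Measurable Y := hX.pow_const _
  have hYpow : ∀ (a : α) (r : ℝ), Y a ^ r = X a ^ (r / 2) := fun a r => by
    rw [hY]
    simp only
    rw [← Real.rpow_mul (hX0 a)]
    congr 1
    ring
  have hY4 : (fun a => Y a ^ (4 : ℝ)) = fun a => X a ^ (2 : ℝ) := by
    funext a; rw [hYpow]; norm_num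
  have hY2 : (fun a => Y a ^ (2 : ℝ)) = fun a => X a ^ (1 : ℝ) := by
    funext a; rw [hYpow]; norm_num
  have hY1 : (fun a => Y a ^ (1 : ℝ)) = fun a => X a ^ (1 / 2 : ℝ) := by
    funext a; rw [hYpow]
  have hintY : Integrable (fun a => Y a ^ (4 : ℝ)) μ := by rw [hY4]; exact hint
  have hI := moment_interpolation hYm hY0 (by norm_num : (0 : ℝ) < 1) (by norm_num : (1 : ℝ) < 2)
    (by norm_num : (2 : ℝ) < 4) hintY
  rw [hY4, hY2, hY1] at hI
  have he1 : ((4 : ℝ) - 2) / (4 - 1) = 2 / 3 := by norm_num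
  have he2 : ((2 : ℝ) - 1) / (4 - 1) = 1 / 3 := by norm_num
  rw [he1, he2] at hI
  set M1 : ℝ := ∫ a, X a ^ (1 : ℝ) ∂μ with hM1
  set Mh : ℝ := ∫ a, X a ^ (1 / 2 : ℝ) ∂μ with hMh
  set M2 : ℝ := ∫ a, X a ^ (2 : ℝ) ∂μ with hM2
  have hM10 : 0 ≤ M1 := integral_nonneg fun a => Real.rpow_nonneg (hX0 a) _
  have hMh0 : 0 ≤ Mh := integral_nonneg fun a => Real.rpow_nonneg (hX0 a) _
  have hM20 : 0 ≤ M2 := integral_nonneg fun a => Real.rpow_nonneg (hX0 a) _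
  -- cube both sides
  have h3 : M1 ^ (3 : ℝ) ≤ (Mh ^ (2 / 3 : ℝ) * M2 ^ (1 / 3 : ℝ)) ^ (3 : ℝ) :=
    Real.rpow_le_rpow hM10 hI (by norm_num)
  have hrhs : (Mh ^ (2 / 3 : ℝ) * M2 ^ (1 / 3 : ℝ)) ^ (3 : ℝ) = Mh ^ (2 : ℝ) * M2 := by
    rw [Real.mul_rpow (Real.rpow_nonneg hMh0 _) (Real.rpow_nonneg hM20 _), ← Real.rpow_mul hMh0,
      ← Real.rpow_mul hM20]
    norm_num
  rwa [hrhs] at h3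

/-! ### §2 `fm(1)³ ≤ fm(1/2)² · fm(2)` at a degenerate tuple -/

/-- **The first moment of the clause functional cubed against its half and second moments** (degenerate
tuple, `N_f ≥ 2`): `fm(1)³ ≤ fm(1/2)² · fm(2)` — all three are moments of the entry sum `X` under the
phase-quenched probability measure `qcdLatticeMeasure`, and `X²` is integrable there (`integrable_propSum_sq`). -/
theorem fm_one_cube_le (hNf : 2 ≤ Nf) (β t : ℝ) (S : ℕ) (f : Fin Nf) (v : Site 4) :
    fm Nf β (fun _ => t) S f v 1 ^ (3 : ℝ) ≤
      fm Nf β (fun _ => t) S f v (1 / 2) ^ (2 : ℝ) * fm Nf β (fun _ => t) S f v 2 := by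
  haveI := isProbabilityMeasure_qcdLatticeMeasure_all (S := 2 * S + 1) β (fun _ : Fin Nf => t)
  rw [negativeFm_eq_fm]
  simp only [fm_eq_integral]
  have h := first_moment_cube_le (measurable_propSum Nf S _ f v) (propSum_nonneg Nf S _ f v)
    (integrable_propSum_sq hNf S β t f v)
  simpa using h

/-! ### §3 The registered glue stub: clause (iii) with its rate on the diagonal -/

/-- GLUE STUB B′.  **Clause (iii) with its rate on the diagonal from a first-moment floor and a
second-moment ceiling.**  For `N_f ≥ 2` identical flavours, under the phase-quenched probability measure
`qcdLatticeMeasure` (where `X^{1/2}`, `X`, `X²` of the entry sum `X` are integrable at a degenerate tuple —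
`integrable_sum_norm_inv_diracMatrix_sq`, `(Σg)² ≤ 144 Σg²`), Hölder interpolation
`E₊[X] ≤ E₊[X^{1/2}]^{2/3} E₊[X²]^{1/3}` (the landed `moment_interpolation` applied to `√X` with exponents
`(1, 2, 4)`) cubes to `E₊[X]³ ≤ E₊[X^{1/2}]² · E₊[X²]`; with a floor `c e^{-(μ a_k n + q log(n+1))} ≤ fm(1)`
(`c > 0`) and a ceiling `fm(2) ≤ C e^{-δ a_k n}` (`C > 0`) along a degenerate trajectory this gives
`LowerWith reg (t,…,t) (1/2) (c^{3/2} C^{-1/2}) ((3μ - δ)/2) (3q/2)`. -/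
theorem stub_lowerWithOfFloorAndCeiling : ∀ {Nf : ℕ}, 2 ≤ Nf → ∀ (reg : QCDRegularisation Nf) (t : ℝ)
    {c μ q C δ : ℝ}, 0 < c → 0 < C →
    (∀ᶠ k in atTop, ∀ S : ℕ, reg.L k ≤ S → ∀ (f : Fin Nf) (n : ℕ), n ≤ S →
      c * Real.exp (-(μ * (reg.a k * n) + q * Real.log (n + 1))) ≤
        fm Nf (reg.β k) (bare reg (fun _ => t) k) S f (Pi.single 0 (n : ℤ)) 1) →
    (∀ᶠ k in atTop, ∀ S : ℕ, reg.L k ≤ S → ∀ (f : Fin Nf) (n : ℕ), n ≤ S →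
      fm Nf (reg.β k) (bare reg (fun _ => t) k) S f (Pi.single 0 (n : ℤ)) 2 ≤
        C * Real.exp (-(δ * (reg.a k * n)))) →
    LowerWith reg (fun _ => t) (1 / 2) (c ^ (3 / 2 : ℝ) * C ^ (-(1 / 2 : ℝ))) ((3 * μ - δ) / 2)
      (3 * q / 2) := by
  intro Nf hNf reg t c μ q C δ hc hC hPF hPC
  filter_upwards [hPF, hPC] with k hPFk hPCk S hS f n hn
  -- the three moments at the constant tuple `x_k = m_crit(k) + a_k t / Z_m(k)`
  set x : ℝ := reg.mcrit k + reg.a k * t / reg.Zm k with hx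
  set F1 : ℝ := fm Nf (reg.β k) (fun _ : Fin Nf => x) S f (Pi.single 0 (n : ℤ)) 1 with hF1
  set Fh : ℝ := fm Nf (reg.β k) (fun _ : Fin Nf => x) S f (Pi.single 0 (n : ℤ)) (1 / 2) with hFh
  set F2 : ℝ := fm Nf (reg.β k) (fun _ : Fin Nf => x) S f (Pi.single 0 (n : ℤ)) 2 with hF2
  set E : ℝ := c * Real.exp (-(μ * (reg.a k * n) + q * Real.log (n + 1))) with hE
  set Cn : ℝ := C * Real.exp (-(δ * (reg.a k * n))) with hCn
  have h1 : E ≤ F1 := hPFk S hS f n hn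
  have h2 : F2 ≤ Cn := hPCk S hS f n hn
  have hE0 : 0 < E := mul_pos hc (Real.exp_pos _)
  have hCn0 : 0 < Cn := mul_pos hC (Real.exp_pos _)
  have hFh0 : 0 ≤ Fh := by
    rw [hFh, negativeFm_eq_fm, fm_eq_integral]
    exact integral_nonneg fun U => Real.rpow_nonneg (propSum_nonneg Nf S _ f _ U) _
  -- `E³ ≤ F1³ ≤ Fh² F2 ≤ Fh² Cn`
  have hcube : F1 ^ (3 : ℝ) ≤ Fh ^ (2 : ℝ) * F2 := fm_one_cube_le hNf (reg.β k) x S f (Pi.single 0 (n : ℤ))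
  have hchain : E ^ (3 : ℝ) ≤ Fh ^ (2 : ℝ) * Cn :=
    (Real.rpow_le_rpow hE0.le h1 (by norm_num)).trans
      (hcube.trans (mul_le_mul_of_nonneg_left h2 (Real.rpow_nonneg hFh0 _)))
  -- divide by `Cn` and take square roots: `(E³ Cn⁻¹)^{1/2} ≤ Fh`
  have hdiv : E ^ (3 : ℝ) * Cn⁻¹ ≤ Fh ^ (2 : ℝ) := by
    rw [← div_eq_mul_inv, div_le_iff₀ hCn0]
    exact hchain
  have hroot : (E ^ (3 : ℝ) * Cn⁻¹) ^ (1 / 2 : ℝ) ≤ Fh := by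
    have h := Real.rpow_le_rpow (mul_nonneg (Real.rpow_nonneg hE0.le _) (inv_pos.2 hCn0).le) hdiv
      (by norm_num : (0 : ℝ) ≤ 1 / 2)
    rwa [← Real.rpow_mul hFh0, show (2 : ℝ) * (1 / 2) = 1 by norm_num, Real.rpow_one] at h
  refine le_trans (le_of_eq ?_) hroot
  -- constants: `c^{3/2} C^{-1/2} e^{-(((3μ-δ)/2) a n + (3q/2) log(n+1))} = (E³ Cn⁻¹)^{1/2}`
  rw [Real.mul_rpow (Real.rpow_nonneg hE0.le _) (inv_pos.2 hCn0).le, ← Real.rpow_mul hE0.le,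
    Real.inv_rpow hCn0.le, ← Real.rpow_neg_one (Cn ^ (1 / 2 : ℝ)), ← Real.rpow_mul hCn0.le,
    show (3 : ℝ) * (1 / 2) = 3 / 2 by norm_num, show (1 / 2 : ℝ) * -1 = -(1 / 2) by norm_num,
    hE, hCn, Real.mul_rpow hc.le (Real.exp_pos _).le, Real.mul_rpow hC.le (Real.exp_pos _).le,
    ← Real.exp_mul, ← Real.exp_mul]
  have hexp : Real.exp (-((3 * μ - δ) / 2 * (reg.a k * n) + 3 * q / 2 * Real.log (n + 1))) =
      Real.exp (-(μ * (reg.a k * n) + q * Real.log (n + 1)) * (3 / 2 : ℝ)) *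
        Real.exp (-(δ * (reg.a k * n)) * (-(1 / 2 : ℝ))) := by
    rw [← Real.exp_add]
    congr 1
    ring
  rw [hexp]
  ring

end Summit.QuantumFields.QCD.Theorems.ChiralMobilityGapAnchor

end
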